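/-
Copyright (c) 2026 the pub-hodgecm-mathlib formalisation cell (harness21).  Prover seat hodgecm-mathlib-F0P3-p02 (g16), 2026-09-01.  Road «S3-ram» seeding wave (LEAD F0P3a-plan (g12) T11-41∕T11-54∕T11-57;
owner F0P3a-p06 (g15)), row «(L)-ram» file L3 = (O2″)-ram: a `v`-level-one `K`-class piece at a 2-deep regular split-torus class, TAME-RAMIFIED place.
-/
import Literature.NumberTheory.Automorphic.TorusTwoDeepLevelTwoStrata            -- ★ p846625 (this lineage, g15): inert (O2″); §1 generic matrix algebra, §3 `exists_torusConj_mul_inv_eq`; ⊇ ★ p846544 socket `classOrbitalIntegral_eq_mul_of_level_frame_of_integral_eq`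
import Literature.NumberTheory.Automorphic.HeisenbergLevelTwoStrataRamified       -- ★ FILE L2 (this seat): `integral_eq_of_levelTwo_strata_of_ramified`; ⊇ ★ FILE L1 generic-`ϖ` chart, ★ `valued_toPlace_uniformizer_of_ramified`
import HarnessLib

/-!
# A `v`-level-one `K`-class piece at a 2-DEEP regular split-torus class, TAME-RAMIFIED place: the strata through the frame and the canonical orbital integral
(Rogawski (1990) §4.9 pp. 54–56, §12.2 p. 173; Kottwitz (1986) §3; Jacobowitz (1962) §5)

Topic `NumberTheory/Automorphic`; namespace `Literature.NumberTheory.Automorphic.UnitaryGroup`.  KERNEL mathematics only: theorems, no definition, no named fact, no instance,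
no notation, no `sorry`.  Cell `pub/hodgecm-mathlib`, crux H413 = `stmt-HodgeConjecture-24833`; road «S3-ram» seeding wave (LEAD F0P3a-plan (g12) T11-41∕T11-54∕T11-57 (2); owner
F0P3a-p06 (g15)), row **«(L)-ram», FILE L3 = (O2″)-ram** (census `F0/P3/F0P3-p02/g16/CENSUS-IL-ram.F0P3p02g16.md` §0.3∕§4; seat F0P3-p02 (g16)); the tame-ramified twin of ★ p846625
`TorusTwoDeepLevelTwoStrata` (this lineage).  CONSUMER: the socket `hX` of F0P3a-p01 (g15)'s ★ p846879 `finsum_delta_mul_classOrbitalIntegral_eq_of_levi_ramified_of_orbital_eq`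
(the ramified LEVI clause (e3) of END's fold v6 `stub_levelOneRowsRam` :118) with `deep d := ∀ i, |d_{i,w} − 1|_w ≤ exp(−2)` ((O1″) ★ p846644 supplies `hV`, place-free).
HONEST LABEL: HC_CM is proved only modulo the 2 remaining named inputs (hLiu418 24832, h413 24833) until rung 0 closes; «S3-ram» is Literature seeding; this file discharges no named fact.

THE MATHEMATICS.  Setting of ★ `TorusDeepOrbitalIntegralStrata` ∕ ★ p846625 at a place `v` of `L⁺` NON-SPLIT and TAMELY RAMIFIED in `L` (`e(w|v) ≠ 1`, `|2|_w = 1`, `q = N𝔭_v = N𝔓_w`):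
`G′_v = U(H′)(L⁺_v)` with its special `K′`; the frame `ψ : G′_v ≃ₜ* U(Φ₃)(L⁺_v)` preserving the level and reading `(ψ g)_w = T g_w T⁻¹`, `T ∈ GL₃(𝒪_w)`; `t = diag(d) ∈ T`
REGULAR (`d₀⁻¹d₁ − 1`, `d₀⁻¹d₂ − 1` units) and 2-DEEP in `w` (`|d_{i,w} − 1|_w ≤ exp(−2)`, i.e. `t_w ≡ 1 (ϖ_w²) = (ϖ_v)`: `t` lies in the `v`-LEVEL-ONE congruence set); `ϖ ∈ L_w` ANY
element with `|ϖ| = exp(−1)` (the fold's block binder); `g` a `K′`-class piece supported in `K′` whose values on the strata of the `v`-level-one class are pinned by `c₂` (boundary: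
residually REGULAR unipotents of `K′` lying in a `v`-level-1 class — there are no residual transvections at a ramified place, ★ p846826, and none on `N ∩ K₃`, ★ p846874) and
`c′ 0, c′ 1, c′ 2` (interior = the `𝔭`-layer: `x_w ≡ 1 (ϖ)` with `red(ϖ⁻¹(x_w − 1))` of rank `s`).  Then for `n ∈ N` and `k := ψ⁻¹(t n)`, exactly as in the inert ★ p846625:
off `K₃`, `g k = 0`; on the boundary-regular stratum of `N ∩ K₃`, `g k = c₂` (`t n = u t u⁻¹` by the surjective regular twist ★ `exists_torusConj_mul_inv_eq`, and
`(ψ⁻¹t)_w = T⁻¹ t_w T ≡ 1 (ϖ_v)` since `|ι_v ϖ_v|_w = exp(−2)` at a ramified `w`, ★ `valued_toPlace_uniformizer_of_ramified`); on the three interior strata `g k = c′ s`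
(`red(ϖ⁻¹(k_w − 1)) = red(T)⁻¹ red(ϖ⁻¹(n_w − 1)) red(T)` by the 2-deep left factor, ★ `redMat_inv_smul_mul_sub_one_of_two_deep`, generic `ϖ`).  With ★ FILE L2
`integral_eq_of_levelTwo_strata_of_ramified` and the socket ★ `classOrbitalIntegral_eq_mul_of_level_frame_of_integral_eq`:
**`Φ(⟦ψ⁻¹t⟧, g) = ν_G(K′) · J₃(t) · (c₂·(1 − q⁻¹) + q⁻¹·(c′ 2·(1 − q⁻¹) + c′ 1·q⁻¹(1 − q⁻¹) + c′ 0·q⁻²))`** — the `G`-side of the ramified LEVI clause, in the binder shape of the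
CORE-ram socket `hX` (inert ★ p846625: `c 2(1−q⁻²) + c 1·q⁻²(1−q⁻¹) + q⁻³(c′ 2(1−q⁻²) + c′ 1·q⁻²(1−q⁻¹) + c′ 0·q⁻³)`).  The rank-1 interior stratum carries both residue square
classes (B-p14 (g37) cert (4)); a piece taking two values `c′ 1^±` there is the sequel (split edition).
* §2 the interior points of `N ∩ K₃` for a generic `ϖ` (`valBound_smul_map_heisElt_sub_one_of_valued_eq`, `valBound_smul_map_sub_one_of_rank_eq_zero_of_valued_eq`).
* §4 the values of `n ↦ g(ψ⁻¹(t n))` (`apply_symm_torus_mul_levelTwo_values_of_ramified`) and §5 the orbital integral (`classOrbitalIntegral_eq_mul_levelTwoStrata_of_torus_twoDeep_of_ramified`).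

## References
* [Rogawski1990] J. D. Rogawski, *Automorphic Representations of Unitary Groups in Three Variables*, Ann. of Math. Stud. 123 (1990), §1.10 p. 9; §4.9 pp. 54–56; §4.3 (4.3.1) p. 43; §12.2 p. 173.
* [Kottwitz1986] R. E. Kottwitz, *Base change for unit elements of Hecke algebras*, Compositio Math. 60 (1986), §3 (congruence filtration).
* [Jacobowitz1962] R. Jacobowitz, *Hermitian forms over local fields*, Amer. J. Math. 84 (1962), §5 (ramified case, `π̄ = −π`).
-/

set_option autoImplicit false

noncomputable section

open MeasureTheory Measure Set Filter Topology NumberField IsDedekindDomain Matrix ValuativeRel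
open scoped ENNReal NNReal Matrix MatrixGroups ValuativeRel WithZero

namespace Literature.NumberTheory.Automorphic.UnitaryGroup

open Literature.NumberTheory.Rogawski1990 (IsRegularElt)
open Literature.NumberTheory.Automorphic Literature.NumberTheory.Automorphic.IntegralReduction Literature.NumberTheory.GaloisRepresentations

variable (L : Type) [Field L] [NumberField L] [IsCMField L] {v : HeightOneSpectrum (𝓞 ↥(maximalRealSubfield L))}
  (w : PlacesOver L v) (hw : IsCMField.complexConj L • w.1 = w.1)

/-! ## §2 The interior points of `N ∩ K₃` for a generic uniformiser `ϖ` -/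

include hw in
/-- **In the chart, for `|x_w|, |y_w| < 1` and ANY `ϖ ∈ L_w` with `|ϖ| = exp(−1)`: `ϖ⁻¹(u(x,z)_w − 1)` is INTEGRAL with CUBE-NILPOTENT reduction** (`= S(x_w/ϖ, z_w/ϖ, −(σx)_w/ϖ)`,
★ `smul_map_heisElt_sub_one`; `|z_w| < 1`; the generic-`ϖ` twin of ★ `valBound_inv_smul_map_heisElt_sub_one`). [cite: Rogawski1990, §1.10 p. 9; §4.9 p. 54] [cite: Kottwitz1986, §3] -/
theorem valBound_smul_map_heisElt_sub_one_of_valued_eq [Invertible (2 : LocalRing L v)] {ϖ : w.1.adicCompletion L} (hϖ : Valued.v ϖ = WithZero.exp (-1 : ℤ))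
    (h2w : Valued.v (2 : w.1.adicCompletion L) = 1) {x : LocalRing L v} {y : HeisRing.skewPart (conjLocal L (IsCMField.complexConj L) v)} (hx : Valued.v (x w) < 1) (hy : Valued.v ((y : LocalRing L v) w) < 1) :
    ValBound 1 (ϖ⁻¹ • ((((HeisRing.heisElt (conjLocal L (IsCMField.complexConj L) v) (conjLocal_conjLocal_cm L v) (cmLocalForm_eq_over L 3 v) x y : ↥(unitaryGroupOfForm (conjLocal L (IsCMField.complexConj L) v) (cmLocalForm L 3 v))) : GL (Fin 3) (LocalRing L v)).val.map (Pi.evalRingHom (fun w' : PlacesOver L v => w'.1.adicCompletion L) w)) - 1)) ∧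
      (redMat (ϖ⁻¹ • ((((HeisRing.heisElt (conjLocal L (IsCMField.complexConj L) v) (conjLocal_conjLocal_cm L v) (cmLocalForm_eq_over L 3 v) x y : ↥(unitaryGroupOfForm (conjLocal L (IsCMField.complexConj L) v) (cmLocalForm L 3 v))) : GL (Fin 3) (LocalRing L v)).val.map (Pi.evalRingHom (fun w' : PlacesOver L v => w'.1.adicCompletion L) w)) - 1))) ^ 3 = 0 := by
  have h1 := fun z => (valued_inv_mul_trichotomy_of_valued_eq L v w hϖ z).1
  have hσx : Valued.v (-((conjLocal L (IsCMField.complexConj L) v x) w)) < 1 := by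
    rw [Valuation.map_neg, valued_conjLocal_apply_of_smul_eq L v w hw]; exact hx
  have hz : Valued.v ((HeisRing.heisZ (conjLocal L (IsCMField.complexConj L) v) x (y : LocalRing L v)) w) < 1 := by
    have hzdef : (HeisRing.heisZ (conjLocal L (IsCMField.complexConj L) v) x (y : LocalRing L v)) w =
        (y : LocalRing L v) w - (⅟ (2 : LocalRing L v)) w * (x w * (conjLocal L (IsCMField.complexConj L) v x) w) := by
      simp only [HeisRing.heisZ, Pi.sub_apply, Pi.mul_apply]
    have hd : Valued.v ((⅟ (2 : LocalRing L v)) w * (x w * (conjLocal L (IsCMField.complexConj L) v x) w)) < 1 := by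
      rw [map_mul, map_mul, valued_invOf_two_apply L v w h2w, one_mul, valued_conjLocal_apply_of_smul_eq L v w hw]
      calc Valued.v (x w) * Valued.v (x w) < 1 * 1 := mul_lt_mul'' hx hx zero_le zero_le
        _ = 1 := mul_one _
    rw [hzdef]
    exact lt_of_le_of_lt (Valuation.map_sub _ _ _) (max_lt hy hd)
  rw [smul_map_heisElt_sub_one L v w]
  exact ⟨valBound_strictUpper L w ((h1 _).2 hx) ((h1 _).2 hz) ((h1 _).2 hσx), by rw [redMat_strictUpper, strictUpper_pow_three]⟩

include hw in
/-- **AN INTERIOR POINT OF `N ∩ K₃`, generic `ϖ`** (`n ∈ K₃`, `rank(red(n_w) − 1) = 0`, `|ϖ| = exp(−1)`): `n_w` and `ϖ⁻¹(n_w − 1)` are integral and `red(ϖ⁻¹(n_w − 1))³ = 0`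
(read in the chart: `|x_w|, |y_w| < 1`, ★ `rank_redMat_map_heisElt_sub_one_eq_zero_iff`; twin of ★ `valBound_inv_smul_map_sub_one_of_rank_eq_zero`). [cite: Rogawski1990, §4.9 p. 54] [cite: Kottwitz1986, §3] -/
theorem valBound_smul_map_sub_one_of_rank_eq_zero_of_valued_eq {ϖ : w.1.adicCompletion L} (hϖ : Valued.v ϖ = WithZero.exp (-1 : ℤ)) (h2w : Valued.v (2 : w.1.adicCompletion L) = 1)
    (n : ↥(unipotentU (conjLocal L (IsCMField.complexConj L) v) (cmLocalForm L 3 v))) (hn : (n : ↥(unitaryGroupOfForm (conjLocal L (IsCMField.complexConj L) v) (cmLocalForm L 3 v))) ∈ cmLocalIntegralLevel L 3 (Matrix.of fun i j : Fin 3 => if i.val + j.val + 1 = 3 then (1 : L) else 0) v)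
    (h0 : (redMat (((n : ↥(unitaryGroupOfForm (conjLocal L (IsCMField.complexConj L) v) (cmLocalForm L 3 v))) : GL (Fin 3) (LocalRing L v)).val.map (Pi.evalRingHom (fun w' : PlacesOver L v => w'.1.adicCompletion L) w)) - 1).rank = 0) :
    ValBound 1 (((n : ↥(unitaryGroupOfForm (conjLocal L (IsCMField.complexConj L) v) (cmLocalForm L 3 v))) : GL (Fin 3) (LocalRing L v)).val.map (Pi.evalRingHom (fun w' : PlacesOver L v => w'.1.adicCompletion L) w)) ∧ ValBound 1 (ϖ⁻¹ • ((((n : ↥(unitaryGroupOfForm (conjLocal L (IsCMField.complexConj L) v) (cmLocalForm L 3 v))) : GL (Fin 3) (LocalRing L v)).val.map (Pi.evalRingHom (fun w' : PlacesOver L v => w'.1.adicCompletion L) w)) - 1)) ∧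
      (redMat (ϖ⁻¹ • ((((n : ↥(unitaryGroupOfForm (conjLocal L (IsCMField.complexConj L) v) (cmLocalForm L 3 v))) : GL (Fin 3) (LocalRing L v)).val.map (Pi.evalRingHom (fun w' : PlacesOver L v => w'.1.adicCompletion L) w)) - 1))) ^ 3 = 0 := by
  have hcne := IsCMField.complexConj_ne_one L
  haveI : Algebra.IsQuadraticExtension ↥(maximalRealSubfield L) L := IsCMField.isQuadraticExtension L
  letI : Invertible (2 : LocalRing L v) := (isUnit_two_localRing L v).invertible
  have hvb : ValBound 1 (((n : ↥(unitaryGroupOfForm (conjLocal L (IsCMField.complexConj L) v) (cmLocalForm L 3 v))) : GL (Fin 3) (LocalRing L v)).val.map (Pi.evalRingHom (fun w' : PlacesOver L v => w'.1.adicCompletion L) w)) := by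
    intro i j
    have h := ((mem_glInt_iff _).1 ((mem_localIntegralLevel_iff_of_smul_eq (IsCMField.complexConj L) 3 _ hcne w hw _).1 hn)).1 i j
    rw [coe_coe_localNonsplitEquiv_apply] at h
    exact (Valuation.mem_integer_iff _ _).1 h
  refine ⟨hvb, ?_⟩
  have hn' := HeisRing.heisElt_heisX_heisY (conjLocal L (IsCMField.complexConj L) v) (conjLocal_conjLocal_cm L v) (cmLocalForm_eq_over L 3 v) n
  rw [← hn'] at hn h0 ⊢
  obtain ⟨hx, hy⟩ := (heisElt_mem_cmLocalIntegralLevel_iff L v w hw h2w _ _).1 hn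
  obtain ⟨hx', hy'⟩ := (rank_redMat_map_heisElt_sub_one_eq_zero_iff L v w hw h2w hx hy).1 h0
  exact valBound_smul_map_heisElt_sub_one_of_valued_eq L w hw hϖ h2w hx' hy'


/-! ## §4 The values of `n ↦ g(ψ⁻¹(t n))` at a 2-deep regular `t`, TAME-RAMIFIED place -/

set_option maxHeartbeats 1600000 in
-- instance-term unification on the CM local carriers (as in ★ FILE D ∕ ★ p846544)
include hw in
/-- **THE STRATA OF A `v`-LEVEL-ONE PIECE THROUGH THE FRAME, TAME-RAMIFIED PLACE.**  `ψ` the level-preserving frame reading `(ψ g)_w = T g_w T⁻¹` (`T ∈ GL₃(𝒪_w)`),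
`t = diag(d) ∈ T` REGULAR (`d₀⁻¹d₁ − 1`, `d₀⁻¹d₂ − 1` units) and 2-DEEP in `w` (`|d_{i,w} − 1|_w ≤ exp(−2)`, i.e. `t_w ≡ 1 (ϖ_v)`), `ϖ ∈ L_w` with `|ϖ| = exp(−1)`,
`g` supported in `K′` with the value pins `hc` (boundary: value `c₂` on residually regular unipotents of `K′` lying in a `v`-level-1 class — token `(ι_v ϖ_v)^1`) and `hc′`
(interior: values `c′ s` on `x_w ≡ 1 (ϖ)` with `red(ϖ⁻¹(x_w − 1))` cube-nilpotent of rank `s`).  Then `n ↦ g(ψ⁻¹(t n))` vanishes off `K₃` and takes the values `c₂, c′ 2, c′ 1, c′ 0`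
on the boundary-regular stratum and the three interior strata of `N ∩ K₃` (the five hypotheses of ★ `integral_eq_of_levelTwo_strata_of_ramified`; the rank-1 boundary
stratum is empty at a ramified place and gets no clause).  Ramified twin of ★ `apply_symm_torus_mul_levelTwo_values`.
[cite: Rogawski1990, §4.9 pp. 54–56; §12.2 p. 173] [cite: Kottwitz1986, §3] [cite: Jacobowitz1962, §5] -/
theorem apply_symm_torus_mul_levelTwo_values_of_ramified (H' : Matrix (Fin 3) (Fin 3) L)
    (ψ : (cmDatum L 3 H').Local v ≃ₜ* ↥(unitaryGroupOfForm (conjLocal L (IsCMField.complexConj L) v) (cmLocalForm L 3 v)))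
    (hψK : ∀ g : (cmDatum L 3 H').Local v, ψ g ∈ cmLocalIntegralLevel L 3 (Matrix.of fun i j : Fin 3 => if i.val + j.val + 1 = 3 then (1 : L) else 0) v ↔
      g ∈ cmLocalIntegralLevel L 3 H' v)
    (T : GL (Fin 3) (w.1.adicCompletion L)) (hT : T ∈ glInt 3 (w.1.adicCompletion L))
    (hψT : ∀ g : (cmDatum L 3 H').Local v, localGLPiEquiv L 3 v
        (((ψ g : ↥(unitaryGroupOfForm (conjLocal L (IsCMField.complexConj L) v) (cmLocalForm L 3 v)))) : GL (Fin 3) (LocalRing L v)) w =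
      T * localGLPiEquiv L 3 v (g.val : GL (Fin 3) (LocalRing L v)) w * T⁻¹)
    (he : v.asIdeal.ramificationIdx' w.1.asIdeal ≠ 1) {ϖ : w.1.adicCompletion L} (hϖ : Valued.v ϖ = WithZero.exp (-1 : ℤ)) (h2w : Valued.v (2 : w.1.adicCompletion L) = 1)
    (t : ↥(torusU (conjLocal L (IsCMField.complexConj L) v) (cmLocalForm L 3 v))) {d : Fin 3 → (LocalRing L v)ˣ}
    (hd : glDiagonal 3 (LocalRing L v) d = ((t : ↥(unitaryGroupOfForm (conjLocal L (IsCMField.complexConj L) v) (cmLocalForm L 3 v))) : GL (Fin 3) (LocalRing L v)))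
    (ha' : IsUnit ((((d 0)⁻¹ * d 1 : (LocalRing L v)ˣ) : LocalRing L v) - 1)) (hb' : IsUnit ((((d 0)⁻¹ * d 2 : (LocalRing L v)ˣ) : LocalRing L v) - 1))
    (ht2 : ∀ i : Fin 3, Valued.v ((((d i : (LocalRing L v)ˣ) : LocalRing L v) w) - 1) ≤ WithZero.exp (-2 : ℤ))
    (g : (cmDatum L 3 H').Local v → ℂ) (hgK : tsupport g ⊆ (cmLocalIntegralLevel L 3 H' v : Set ((cmDatum L 3 H').Local v)))
    (c₂ : ℂ) (c' : ℕ → ℂ) (hc : ∀ x : ((cmDatum L 3 H').Local v), (x ∈ cmLocalIntegralLevel L 3 H' v ∧ (redMat (((x).val : GL (Fin 3) (UnitaryGroup.LocalRing L v)).val.map (Pi.evalRingHom (fun w' : PlacesOver L v => w'.1.adicCompletion L) w)) - 1) ^ 3 = 0 ∧ (redMat (((x).val : GL (Fin 3) (UnitaryGroup.LocalRing L v)).val.map (Pi.evalRingHom (fun w' : PlacesOver L v => w'.1.adicCompletion L) w)) - 1).rank = 2 ∧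
        ∃ y : ((cmDatum L 3 H').Local v), (∀ a b, Valued.v (((toPlace v w (HeckeCharacter.uniformizer ↥(maximalRealSubfield L) v : v.adicCompletion ↥(maximalRealSubfield L))) ^ 1)⁻¹ *
        ((((localNonsplitEquiv (IsCMField.complexConj L) H' (IsCMField.complexConj_ne_one L) w hw (y * x * y⁻¹) :
            ↥(unitaryGroupOfForm (galAdicCompletionMap (L := L) (IsCMField.complexConj L) hw) (placeForm H' w.1))) : GL (Fin 3) (w.1.adicCompletion L)) :
              Matrix (Fin 3) (Fin 3) (w.1.adicCompletion L)) a b - (1 : Matrix (Fin 3) (Fin 3) (w.1.adicCompletion L)) a b)) ≤ 1)) → g x = c₂)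
    (hc' : ((∀ x : ((cmDatum L 3 H').Local v), (x ∈ cmLocalIntegralLevel L 3 H' v ∧ (∀ a b, Valued.v (ϖ⁻¹ * ((((x).val : GL (Fin 3) (UnitaryGroup.LocalRing L v)).val.map (Pi.evalRingHom (fun w' : PlacesOver L v => w'.1.adicCompletion L) w)) a b - (1 : Matrix (Fin 3) (Fin 3) (w.1.adicCompletion L)) a b)) ≤ 1) ∧
        (redMat (ϖ⁻¹ • ((((x).val : GL (Fin 3) (UnitaryGroup.LocalRing L v)).val.map (Pi.evalRingHom (fun w' : PlacesOver L v => w'.1.adicCompletion L) w)) - 1))) ^ 3 = 0 ∧ (redMat (ϖ⁻¹ • ((((x).val : GL (Fin 3) (UnitaryGroup.LocalRing L v)).val.map (Pi.evalRingHom (fun w' : PlacesOver L v => w'.1.adicCompletion L) w)) - 1))).rank = 0) → g x = c' 0) ∧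
      (∀ x : ((cmDatum L 3 H').Local v), (x ∈ cmLocalIntegralLevel L 3 H' v ∧ (∀ a b, Valued.v (ϖ⁻¹ * ((((x).val : GL (Fin 3) (UnitaryGroup.LocalRing L v)).val.map (Pi.evalRingHom (fun w' : PlacesOver L v => w'.1.adicCompletion L) w)) a b - (1 : Matrix (Fin 3) (Fin 3) (w.1.adicCompletion L)) a b)) ≤ 1) ∧
        (redMat (ϖ⁻¹ • ((((x).val : GL (Fin 3) (UnitaryGroup.LocalRing L v)).val.map (Pi.evalRingHom (fun w' : PlacesOver L v => w'.1.adicCompletion L) w)) - 1))) ^ 3 = 0 ∧ (redMat (ϖ⁻¹ • ((((x).val : GL (Fin 3) (UnitaryGroup.LocalRing L v)).val.map (Pi.evalRingHom (fun w' : PlacesOver L v => w'.1.adicCompletion L) w)) - 1))).rank = 1) → g x = c' 1) ∧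
      (∀ x : ((cmDatum L 3 H').Local v), (x ∈ cmLocalIntegralLevel L 3 H' v ∧ (∀ a b, Valued.v (ϖ⁻¹ * ((((x).val : GL (Fin 3) (UnitaryGroup.LocalRing L v)).val.map (Pi.evalRingHom (fun w' : PlacesOver L v => w'.1.adicCompletion L) w)) a b - (1 : Matrix (Fin 3) (Fin 3) (w.1.adicCompletion L)) a b)) ≤ 1) ∧
        (redMat (ϖ⁻¹ • ((((x).val : GL (Fin 3) (UnitaryGroup.LocalRing L v)).val.map (Pi.evalRingHom (fun w' : PlacesOver L v => w'.1.adicCompletion L) w)) - 1))) ^ 3 = 0 ∧ (redMat (ϖ⁻¹ • ((((x).val : GL (Fin 3) (UnitaryGroup.LocalRing L v)).val.map (Pi.evalRingHom (fun w' : PlacesOver L v => w'.1.adicCompletion L) w)) - 1))).rank = 2) → g x = c' 2))) :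
    (∀ n : ↥(unipotentU (conjLocal L (IsCMField.complexConj L) v) (cmLocalForm L 3 v)), (n : ↥(unitaryGroupOfForm (conjLocal L (IsCMField.complexConj L) v) (cmLocalForm L 3 v))) ∈
          cmLocalIntegralLevel L 3 (Matrix.of fun i j : Fin 3 => if i.val + j.val + 1 = 3 then (1 : L) else 0) v →
        (redMat (((n : ↥(unitaryGroupOfForm (conjLocal L (IsCMField.complexConj L) v) (cmLocalForm L 3 v))) : GL (Fin 3) (LocalRing L v)).val.map (Pi.evalRingHom (fun w' : PlacesOver L v => w'.1.adicCompletion L) w)) - 1).rank = 2 →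
        g (ψ.symm ((t : ↥(unitaryGroupOfForm (conjLocal L (IsCMField.complexConj L) v) (cmLocalForm L 3 v))) *
        (n : ↥(unitaryGroupOfForm (conjLocal L (IsCMField.complexConj L) v) (cmLocalForm L 3 v))))) = c₂) ∧
    (∀ n : ↥(unipotentU (conjLocal L (IsCMField.complexConj L) v) (cmLocalForm L 3 v)), (n : ↥(unitaryGroupOfForm (conjLocal L (IsCMField.complexConj L) v) (cmLocalForm L 3 v))) ∈
          cmLocalIntegralLevel L 3 (Matrix.of fun i j : Fin 3 => if i.val + j.val + 1 = 3 then (1 : L) else 0) v →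
        (redMat (((n : ↥(unitaryGroupOfForm (conjLocal L (IsCMField.complexConj L) v) (cmLocalForm L 3 v))) : GL (Fin 3) (LocalRing L v)).val.map (Pi.evalRingHom (fun w' : PlacesOver L v => w'.1.adicCompletion L) w)) - 1).rank = 0 →
        (redMat (ϖ⁻¹ •
          ((((n : ↥(unitaryGroupOfForm (conjLocal L (IsCMField.complexConj L) v) (cmLocalForm L 3 v))) : GL (Fin 3) (LocalRing L v)).val.map (Pi.evalRingHom (fun w' : PlacesOver L v => w'.1.adicCompletion L) w)) - 1))).rank = 2 →
        g (ψ.symm ((t : ↥(unitaryGroupOfForm (conjLocal L (IsCMField.complexConj L) v) (cmLocalForm L 3 v))) *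
        (n : ↥(unitaryGroupOfForm (conjLocal L (IsCMField.complexConj L) v) (cmLocalForm L 3 v))))) = c' 2) ∧
    (∀ n : ↥(unipotentU (conjLocal L (IsCMField.complexConj L) v) (cmLocalForm L 3 v)), (n : ↥(unitaryGroupOfForm (conjLocal L (IsCMField.complexConj L) v) (cmLocalForm L 3 v))) ∈
          cmLocalIntegralLevel L 3 (Matrix.of fun i j : Fin 3 => if i.val + j.val + 1 = 3 then (1 : L) else 0) v →
        (redMat (((n : ↥(unitaryGroupOfForm (conjLocal L (IsCMField.complexConj L) v) (cmLocalForm L 3 v))) : GL (Fin 3) (LocalRing L v)).val.map (Pi.evalRingHom (fun w' : PlacesOver L v => w'.1.adicCompletion L) w)) - 1).rank = 0 →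
        (redMat (ϖ⁻¹ •
          ((((n : ↥(unitaryGroupOfForm (conjLocal L (IsCMField.complexConj L) v) (cmLocalForm L 3 v))) : GL (Fin 3) (LocalRing L v)).val.map (Pi.evalRingHom (fun w' : PlacesOver L v => w'.1.adicCompletion L) w)) - 1))).rank = 1 →
        g (ψ.symm ((t : ↥(unitaryGroupOfForm (conjLocal L (IsCMField.complexConj L) v) (cmLocalForm L 3 v))) *
        (n : ↥(unitaryGroupOfForm (conjLocal L (IsCMField.complexConj L) v) (cmLocalForm L 3 v))))) = c' 1) ∧
    (∀ n : ↥(unipotentU (conjLocal L (IsCMField.complexConj L) v) (cmLocalForm L 3 v)), (n : ↥(unitaryGroupOfForm (conjLocal L (IsCMField.complexConj L) v) (cmLocalForm L 3 v))) ∈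
          cmLocalIntegralLevel L 3 (Matrix.of fun i j : Fin 3 => if i.val + j.val + 1 = 3 then (1 : L) else 0) v →
        (redMat (((n : ↥(unitaryGroupOfForm (conjLocal L (IsCMField.complexConj L) v) (cmLocalForm L 3 v))) : GL (Fin 3) (LocalRing L v)).val.map (Pi.evalRingHom (fun w' : PlacesOver L v => w'.1.adicCompletion L) w)) - 1).rank = 0 →
        (redMat (ϖ⁻¹ •
          ((((n : ↥(unitaryGroupOfForm (conjLocal L (IsCMField.complexConj L) v) (cmLocalForm L 3 v))) : GL (Fin 3) (LocalRing L v)).val.map (Pi.evalRingHom (fun w' : PlacesOver L v => w'.1.adicCompletion L) w)) - 1))).rank = 0 →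
        g (ψ.symm ((t : ↥(unitaryGroupOfForm (conjLocal L (IsCMField.complexConj L) v) (cmLocalForm L 3 v))) *
        (n : ↥(unitaryGroupOfForm (conjLocal L (IsCMField.complexConj L) v) (cmLocalForm L 3 v))))) = c' 0) ∧
    (∀ n : ↥(unipotentU (conjLocal L (IsCMField.complexConj L) v) (cmLocalForm L 3 v)), (n : ↥(unitaryGroupOfForm (conjLocal L (IsCMField.complexConj L) v) (cmLocalForm L 3 v))) ∉
          cmLocalIntegralLevel L 3 (Matrix.of fun i j : Fin 3 => if i.val + j.val + 1 = 3 then (1 : L) else 0) v → g (ψ.symm ((t : ↥(unitaryGroupOfForm (conjLocal L (IsCMField.complexConj L) v) (cmLocalForm L 3 v))) *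
        (n : ↥(unitaryGroupOfForm (conjLocal L (IsCMField.complexConj L) v) (cmLocalForm L 3 v))))) = 0) := by
  have hcne := IsCMField.complexConj_ne_one L
  haveI : Algebra.IsQuadraticExtension ↥(maximalRealSubfield L) L := IsCMField.isQuadraticExtension L
  letI : Invertible (2 : LocalRing L v) := (isUnit_two_localRing L v).invertible
  obtain ⟨he1, he2, -⟩ := exp_neg_lt_one
  have hP0 : ϖ ≠ 0 := fun h => by
    rw [h, map_zero] at hϖ; exact WithZero.zero_ne_coe hϖ
  have hP1 : Valued.v ϖ < 1 := by rw [hϖ]; exact he1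
  have hP2 : Valued.v (ϖ ^ 2) = WithZero.exp (-2 : ℤ) := by
    rw [map_pow, hϖ, sq, ← WithZero.exp_add]; norm_num
  -- at a tame-ramified place `|ι_v ϖ_v|_w = exp(−2) = |ϖ_w²|`: the socket's `v`-level-1 token and the 2-deep torus agree
  have hQ1 : Valued.v ((toPlace v w (HeckeCharacter.uniformizer ↥(maximalRealSubfield L) v : v.adicCompletion ↥(maximalRealSubfield L))) ^ 1) = WithZero.exp (-2 : ℤ) := by
    rw [pow_one]; exact (valued_toPlace_uniformizer_of_ramified L (IsCMField.complexConj L) hcne w hw he).1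
  have ht1 : ∀ i : Fin 3, Valued.v ((((d i : (LocalRing L v)ˣ) : LocalRing L v) w) - 1) < 1 := fun i => lt_of_le_of_lt (ht2 i) he2
  have htK := torus_three_mem_cmLocalIntegralLevel_of_deep L w hw t hd ht1
  have htred := redMat_map_torus_three_eq_one_of_deep L w t hd ht1
  have hvbT := valBound_coe_and_inv_of_mem_glInt L w hT
  -- integrality of `w`-components from `K₃`-membership
  have hvb : ∀ {Y : GL (Fin 3) (LocalRing L v)}, localGLPiEquiv L 3 v Y w ∈ glInt 3 (w.1.adicCompletion L) →
      ValBound 1 ((Y : Matrix (Fin 3) (Fin 3) (LocalRing L v)).map (Pi.evalRingHom (fun w' : PlacesOver L v => w'.1.adicCompletion L) w)) := by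
    intro Y hY i j
    have h := ((mem_glInt_iff _).1 hY).1 i j
    rw [GLn.coe_piEquiv_apply] at h
    exact (Valuation.mem_integer_iff _ _).1 h
  have htint : localGLPiEquiv L 3 v ((t : ↥(unitaryGroupOfForm (conjLocal L (IsCMField.complexConj L) v) (cmLocalForm L 3 v))) : GL (Fin 3) (LocalRing L v)) w ∈ glInt 3 (w.1.adicCompletion L) :=
    (mem_localIntegralLevel_iff_of_smul_eq (IsCMField.complexConj L) 3 _ hcne w hw _).1 htK
  have htvb : ValBound 1 (((t : ↥(unitaryGroupOfForm (conjLocal L (IsCMField.complexConj L) v) (cmLocalForm L 3 v))) : GL (Fin 3) (LocalRing L v)).val.map (Pi.evalRingHom (fun w' : PlacesOver L v => w'.1.adicCompletion L) w)) := hvb htint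
  -- `t_w = diagonal(d_w)` and its 2-deepness `(ϖ²)⁻¹(t_w − 1)` integral
  have htmat : (((t : ↥(unitaryGroupOfForm (conjLocal L (IsCMField.complexConj L) v) (cmLocalForm L 3 v))) : GL (Fin 3) (LocalRing L v)).val.map (Pi.evalRingHom (fun w' : PlacesOver L v => w'.1.adicCompletion L) w)) = Matrix.diagonal fun i => ((d i : (LocalRing L v)ˣ) : LocalRing L v) w := by
    rw [← hd, coe_glDiagonal, Matrix.diagonal_map (RingHom.map_zero (Pi.evalRingHom (fun w' : PlacesOver L v => w'.1.adicCompletion L) w))]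
    rfl
  have ht2vb : ValBound 1 ((ϖ ^ 2)⁻¹ • ((((t : ↥(unitaryGroupOfForm (conjLocal L (IsCMField.complexConj L) v) (cmLocalForm L 3 v))) : GL (Fin 3) (LocalRing L v)).val.map (Pi.evalRingHom (fun w' : PlacesOver L v => w'.1.adicCompletion L) w)) - 1)) := by
    rw [htmat]
    intro i j
    rw [Matrix.smul_apply, Matrix.sub_apply, Matrix.diagonal_apply, Matrix.one_apply, smul_eq_mul]
    by_cases hij : i = j
    · subst hij
      rw [if_pos rfl, if_pos rfl, ← v_le_one_iff_valuation_le_one, map_mul, map_inv₀, hP2]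
      calc (WithZero.exp (-2 : ℤ))⁻¹ * Valued.v ((((d i : (LocalRing L v)ˣ) : LocalRing L v) w) - 1) ≤ (WithZero.exp (-2 : ℤ))⁻¹ * WithZero.exp (-2 : ℤ) :=
            mul_le_mul' le_rfl (ht2 i)
        _ = 1 := inv_mul_cancel₀ WithZero.coe_ne_zero
    · rw [if_neg hij, if_neg hij, sub_zero, mul_zero, ← v_le_one_iff_valuation_le_one, map_zero]; exact zero_le
  have ht1vb : ValBound 1 (((toPlace v w (HeckeCharacter.uniformizer ↥(maximalRealSubfield L) v : v.adicCompletion ↥(maximalRealSubfield L))) ^ 1)⁻¹ • ((((t : ↥(unitaryGroupOfForm (conjLocal L (IsCMField.complexConj L) v) (cmLocalForm L 3 v))) : GL (Fin 3) (LocalRing L v)).val.map (Pi.evalRingHom (fun w' : PlacesOver L v => w'.1.adicCompletion L) w)) - 1)) := by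
    rw [htmat]
    intro i j
    rw [Matrix.smul_apply, Matrix.sub_apply, Matrix.diagonal_apply, Matrix.one_apply, smul_eq_mul]
    by_cases hij : i = j
    · subst hij
      rw [if_pos rfl, if_pos rfl, ← v_le_one_iff_valuation_le_one, map_mul, map_inv₀, hQ1]
      calc (WithZero.exp (-2 : ℤ))⁻¹ * Valued.v ((((d i : (LocalRing L v)ˣ) : LocalRing L v) w) - 1) ≤ (WithZero.exp (-2 : ℤ))⁻¹ * WithZero.exp (-2 : ℤ) :=
            mul_le_mul' le_rfl (ht2 i)
        _ = 1 := inv_mul_cancel₀ WithZero.coe_ne_zero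
    · rw [if_neg hij, if_neg hij, sub_zero, mul_zero, ← v_le_one_iff_valuation_le_one, map_zero]; exact zero_le
  -- the frame point `k = ψ⁻¹(t n)`: `k ∈ K′`, `k_w = T⁻¹ X T`, `X = t_w n_w ∈ GL₃(𝒪_w)`
  have key : ∀ n : ↥(unipotentU (conjLocal L (IsCMField.complexConj L) v) (cmLocalForm L 3 v)), (n : ↥(unitaryGroupOfForm (conjLocal L (IsCMField.complexConj L) v) (cmLocalForm L 3 v))) ∈ cmLocalIntegralLevel L 3 (Matrix.of fun i j : Fin 3 => if i.val + j.val + 1 = 3 then (1 : L) else 0) v →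
      ψ.symm ((t : ↥(unitaryGroupOfForm (conjLocal L (IsCMField.complexConj L) v) (cmLocalForm L 3 v))) * (n : ↥(unitaryGroupOfForm (conjLocal L (IsCMField.complexConj L) v) (cmLocalForm L 3 v)))) ∈ cmLocalIntegralLevel L 3 H' v ∧
      ∃ X : GL (Fin 3) (w.1.adicCompletion L), X ∈ glInt 3 (w.1.adicCompletion L) ∧
        (((ψ.symm ((t : ↥(unitaryGroupOfForm (conjLocal L (IsCMField.complexConj L) v) (cmLocalForm L 3 v))) * (n : ↥(unitaryGroupOfForm (conjLocal L (IsCMField.complexConj L) v) (cmLocalForm L 3 v))))).val : GL (Fin 3) (UnitaryGroup.LocalRing L v)).val.map (Pi.evalRingHom (fun w' : PlacesOver L v => w'.1.adicCompletion L) w)) = ((T⁻¹ * X * T : GL (Fin 3) (w.1.adicCompletion L)) : Matrix (Fin 3) (Fin 3) (w.1.adicCompletion L)) ∧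
        (X : Matrix (Fin 3) (Fin 3) (w.1.adicCompletion L)) = (((t : ↥(unitaryGroupOfForm (conjLocal L (IsCMField.complexConj L) v) (cmLocalForm L 3 v))) : GL (Fin 3) (LocalRing L v)).val.map (Pi.evalRingHom (fun w' : PlacesOver L v => w'.1.adicCompletion L) w)) * (((n : ↥(unitaryGroupOfForm (conjLocal L (IsCMField.complexConj L) v) (cmLocalForm L 3 v))) : GL (Fin 3) (LocalRing L v)).val.map (Pi.evalRingHom (fun w' : PlacesOver L v => w'.1.adicCompletion L) w)) := by
    intro n hn
    have hψk : ψ (ψ.symm ((t : ↥(unitaryGroupOfForm (conjLocal L (IsCMField.complexConj L) v) (cmLocalForm L 3 v))) * (n : ↥(unitaryGroupOfForm (conjLocal L (IsCMField.complexConj L) v) (cmLocalForm L 3 v))))) = ((t : ↥(unitaryGroupOfForm (conjLocal L (IsCMField.complexConj L) v) (cmLocalForm L 3 v))) * (n : ↥(unitaryGroupOfForm (conjLocal L (IsCMField.complexConj L) v) (cmLocalForm L 3 v)))) := ψ.apply_symm_apply _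
    have hkK : ψ.symm ((t : ↥(unitaryGroupOfForm (conjLocal L (IsCMField.complexConj L) v) (cmLocalForm L 3 v))) * (n : ↥(unitaryGroupOfForm (conjLocal L (IsCMField.complexConj L) v) (cmLocalForm L 3 v)))) ∈ cmLocalIntegralLevel L 3 H' v := (hψK _).1 (by rw [hψk]; exact Subgroup.mul_mem _ htK hn)
    obtain ⟨X, hX⟩ : ∃ X : GL (Fin 3) (w.1.adicCompletion L), X = localGLPiEquiv L 3 v (((ψ (ψ.symm ((t : ↥(unitaryGroupOfForm (conjLocal L (IsCMField.complexConj L) v) (cmLocalForm L 3 v))) * (n : ↥(unitaryGroupOfForm (conjLocal L (IsCMField.complexConj L) v) (cmLocalForm L 3 v))))) : ↥(unitaryGroupOfForm (conjLocal L (IsCMField.complexConj L) v) (cmLocalForm L 3 v)))) : GL (Fin 3) (LocalRing L v)) w := ⟨_, rfl⟩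
    refine ⟨hkK, X, ?_, ?_, ?_⟩
    · rw [hX]; exact (mem_localIntegralLevel_iff_of_smul_eq (IsCMField.complexConj L) 3 _ hcne w hw _).1 ((hψK _).2 hkK)
    · have h := hψT (ψ.symm ((t : ↥(unitaryGroupOfForm (conjLocal L (IsCMField.complexConj L) v) (cmLocalForm L 3 v))) * (n : ↥(unitaryGroupOfForm (conjLocal L (IsCMField.complexConj L) v) (cmLocalForm L 3 v)))))
      rw [← hX] at h
      have hkw : localGLPiEquiv L 3 v ((ψ.symm ((t : ↥(unitaryGroupOfForm (conjLocal L (IsCMField.complexConj L) v) (cmLocalForm L 3 v))) * (n : ↥(unitaryGroupOfForm (conjLocal L (IsCMField.complexConj L) v) (cmLocalForm L 3 v))))).val : GL (Fin 3) (LocalRing L v)) w = T⁻¹ * X * T := by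
        rw [h]; group
      rw [← hkw, GLn.coe_piEquiv_apply]
    · rw [hX, hψk, GLn.coe_piEquiv_apply, Subgroup.coe_mul, Units.val_mul, Matrix.map_mul]
  -- the `v`-level-1 witness for `k`: `y k y⁻¹ = ψ⁻¹ t` with `(ψ⁻¹ t)_w = T⁻¹ t_w T ≡ 1 (ϖ_v) = (ϖ_w²)`
  have wit : ∀ n : ↥(unipotentU (conjLocal L (IsCMField.complexConj L) v) (cmLocalForm L 3 v)), ∃ y : (cmDatum L 3 H').Local v, (∀ a b, Valued.v ((((toPlace v w (HeckeCharacter.uniformizer ↥(maximalRealSubfield L) v : v.adicCompletion ↥(maximalRealSubfield L)))) ^ 1)⁻¹ *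
        ((((localNonsplitEquiv (IsCMField.complexConj L) H' (IsCMField.complexConj_ne_one L) w hw (y * ψ.symm ((t : ↥(unitaryGroupOfForm (conjLocal L (IsCMField.complexConj L) v) (cmLocalForm L 3 v))) * (n : ↥(unitaryGroupOfForm (conjLocal L (IsCMField.complexConj L) v) (cmLocalForm L 3 v)))) * y⁻¹) :
            ↥(unitaryGroupOfForm (galAdicCompletionMap (L := L) (IsCMField.complexConj L) hw) (placeForm H' w.1))) : GL (Fin 3) (w.1.adicCompletion L)) :
              Matrix (Fin 3) (Fin 3) (w.1.adicCompletion L)) a b - (1 : Matrix (Fin 3) (Fin 3) (w.1.adicCompletion L)) a b)) ≤ 1) := by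
    intro n
    obtain ⟨u, hu⟩ := exists_torusConj_mul_inv_eq L t hd ha' hb' n
    have htn : ((t : ↥(unitaryGroupOfForm (conjLocal L (IsCMField.complexConj L) v) (cmLocalForm L 3 v))) * (n : ↥(unitaryGroupOfForm (conjLocal L (IsCMField.complexConj L) v) (cmLocalForm L 3 v)))) = (u : ↥(unitaryGroupOfForm (conjLocal L (IsCMField.complexConj L) v) (cmLocalForm L 3 v))) * (t : ↥(unitaryGroupOfForm (conjLocal L (IsCMField.complexConj L) v) (cmLocalForm L 3 v))) * (u : ↥(unitaryGroupOfForm (conjLocal L (IsCMField.complexConj L) v) (cmLocalForm L 3 v)))⁻¹ := by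
      rw [HeisRing.coe_mul_torus_mul_inv (conjLocal L (IsCMField.complexConj L) v) t u, hu]
    refine ⟨ψ.symm ((u : ↥(unitaryGroupOfForm (conjLocal L (IsCMField.complexConj L) v) (cmLocalForm L 3 v)))⁻¹), fun a b => ?_⟩
    have hyky : ψ.symm ((u : ↥(unitaryGroupOfForm (conjLocal L (IsCMField.complexConj L) v) (cmLocalForm L 3 v)))⁻¹) * ψ.symm ((t : ↥(unitaryGroupOfForm (conjLocal L (IsCMField.complexConj L) v) (cmLocalForm L 3 v))) * (n : ↥(unitaryGroupOfForm (conjLocal L (IsCMField.complexConj L) v) (cmLocalForm L 3 v)))) * (ψ.symm ((u : ↥(unitaryGroupOfForm (conjLocal L (IsCMField.complexConj L) v) (cmLocalForm L 3 v)))⁻¹))⁻¹ = ψ.symm (t : ↥(unitaryGroupOfForm (conjLocal L (IsCMField.complexConj L) v) (cmLocalForm L 3 v))) := by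
      apply ψ.injective
      simp only [map_mul, map_inv, ψ.apply_symm_apply]
      rw [htn]; group
    have h := hψT (ψ.symm (t : ↥(unitaryGroupOfForm (conjLocal L (IsCMField.complexConj L) v) (cmLocalForm L 3 v))))
    rw [ψ.apply_symm_apply] at h
    have hγw : localGLPiEquiv L 3 v ((ψ.symm (t : ↥(unitaryGroupOfForm (conjLocal L (IsCMField.complexConj L) v) (cmLocalForm L 3 v)))).val : GL (Fin 3) (LocalRing L v)) w =
        T⁻¹ * localGLPiEquiv L 3 v ((t : ↥(unitaryGroupOfForm (conjLocal L (IsCMField.complexConj L) v) (cmLocalForm L 3 v))) : GL (Fin 3) (LocalRing L v)) w * T := by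
      rw [h]; group
    have hγmat : (((ψ.symm (t : ↥(unitaryGroupOfForm (conjLocal L (IsCMField.complexConj L) v) (cmLocalForm L 3 v)))).val : GL (Fin 3) (UnitaryGroup.LocalRing L v)).val.map (Pi.evalRingHom (fun w' : PlacesOver L v => w'.1.adicCompletion L) w)) =
        ((T⁻¹ : GL (Fin 3) (w.1.adicCompletion L)) : Matrix (Fin 3) (Fin 3) (w.1.adicCompletion L)) * (((t : ↥(unitaryGroupOfForm (conjLocal L (IsCMField.complexConj L) v) (cmLocalForm L 3 v))) : GL (Fin 3) (LocalRing L v)).val.map (Pi.evalRingHom (fun w' : PlacesOver L v => w'.1.adicCompletion L) w)) * (T : Matrix (Fin 3) (Fin 3) (w.1.adicCompletion L)) := by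
      rw [← GLn.coe_piEquiv_apply, hγw, Units.val_mul, Units.val_mul, GLn.coe_piEquiv_apply]
    have hM : ValBound 1 (((T⁻¹ : GL (Fin 3) (w.1.adicCompletion L)) : Matrix (Fin 3) (Fin 3) (w.1.adicCompletion L)) * (((toPlace v w (HeckeCharacter.uniformizer ↥(maximalRealSubfield L) v : v.adicCompletion ↥(maximalRealSubfield L))) ^ 1)⁻¹ • ((((t : ↥(unitaryGroupOfForm (conjLocal L (IsCMField.complexConj L) v) (cmLocalForm L 3 v))) : GL (Fin 3) (LocalRing L v)).val.map (Pi.evalRingHom (fun w' : PlacesOver L v => w'.1.adicCompletion L) w)) - 1)) * (T : Matrix (Fin 3) (Fin 3) (w.1.adicCompletion L))) := by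
      have h1 := hvbT.2.mul ht1vb; rw [one_mul] at h1
      have h2 := h1.mul hvbT.1; rw [one_mul] at h2
      exact h2
    have e := congrFun (congrFun (inv_smul_coe_inv_mul_mul_coe_sub_one L w (((toPlace v w (HeckeCharacter.uniformizer ↥(maximalRealSubfield L) v : v.adicCompletion ↥(maximalRealSubfield L))) ^ 1)⁻¹) T (((t : ↥(unitaryGroupOfForm (conjLocal L (IsCMField.complexConj L) v) (cmLocalForm L 3 v))) : GL (Fin 3) (LocalRing L v)).val.map (Pi.evalRingHom (fun w' : PlacesOver L v => w'.1.adicCompletion L) w))) a) b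
    rw [Matrix.smul_apply, Matrix.sub_apply, smul_eq_mul] at e
    rw [hyky, coe_coe_localNonsplitEquiv_apply, hγmat, e]
    exact (v_le_one_iff_valuation_le_one _).2 (hM a b)
  -- residual nilpotency of `n_w` on `N` (★ FILE A)
  have hn3 : ∀ n : ↥(unipotentU (conjLocal L (IsCMField.complexConj L) v) (cmLocalForm L 3 v)), (redMat (((n : ↥(unitaryGroupOfForm (conjLocal L (IsCMField.complexConj L) v) (cmLocalForm L 3 v))) : GL (Fin 3) (LocalRing L v)).val.map (Pi.evalRingHom (fun w' : PlacesOver L v => w'.1.adicCompletion L) w)) - 1) ^ 3 = 0 := fun n => by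
    rw [← HeisRing.heisElt_heisX_heisY (conjLocal L (IsCMField.complexConj L) v) (conjLocal_conjLocal_cm L v) (cmLocalForm_eq_over L 3 v) n]
    exact redMat_map_heisElt_sub_one_pow_three L v w hw _ _
  -- BOUNDARY strata: residual type transported through `T⁻¹(t_w n_w)T`
  have bd : ∀ n : ↥(unipotentU (conjLocal L (IsCMField.complexConj L) v) (cmLocalForm L 3 v)), (n : ↥(unitaryGroupOfForm (conjLocal L (IsCMField.complexConj L) v) (cmLocalForm L 3 v))) ∈ cmLocalIntegralLevel L 3 (Matrix.of fun i j : Fin 3 => if i.val + j.val + 1 = 3 then (1 : L) else 0) v → ∀ r : ℕ, (redMat (((n : ↥(unitaryGroupOfForm (conjLocal L (IsCMField.complexConj L) v) (cmLocalForm L 3 v))) : GL (Fin 3) (LocalRing L v)).val.map (Pi.evalRingHom (fun w' : PlacesOver L v => w'.1.adicCompletion L) w)) - 1).rank = r →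
      ψ.symm ((t : ↥(unitaryGroupOfForm (conjLocal L (IsCMField.complexConj L) v) (cmLocalForm L 3 v))) * (n : ↥(unitaryGroupOfForm (conjLocal L (IsCMField.complexConj L) v) (cmLocalForm L 3 v)))) ∈ cmLocalIntegralLevel L 3 H' v ∧ (redMat (((ψ.symm ((t : ↥(unitaryGroupOfForm (conjLocal L (IsCMField.complexConj L) v) (cmLocalForm L 3 v))) * (n : ↥(unitaryGroupOfForm (conjLocal L (IsCMField.complexConj L) v) (cmLocalForm L 3 v))))).val : GL (Fin 3) (UnitaryGroup.LocalRing L v)).val.map (Pi.evalRingHom (fun w' : PlacesOver L v => w'.1.adicCompletion L) w)) - 1) ^ 3 = 0 ∧ (redMat (((ψ.symm ((t : ↥(unitaryGroupOfForm (conjLocal L (IsCMField.complexConj L) v) (cmLocalForm L 3 v))) * (n : ↥(unitaryGroupOfForm (conjLocal L (IsCMField.complexConj L) v) (cmLocalForm L 3 v))))).val : GL (Fin 3) (UnitaryGroup.LocalRing L v)).val.map (Pi.evalRingHom (fun w' : PlacesOver L v => w'.1.adicCompletion L) w)) - 1).rank = r := by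
    intro n hn r hr
    obtain ⟨hkK, X, hXint, hkmat, hXmat⟩ := key n hn
    have hnint : localGLPiEquiv L 3 v ((n : ↥(unitaryGroupOfForm (conjLocal L (IsCMField.complexConj L) v) (cmLocalForm L 3 v))) : GL (Fin 3) (LocalRing L v)) w ∈ glInt 3 (w.1.adicCompletion L) :=
      (mem_localIntegralLevel_iff_of_smul_eq (IsCMField.complexConj L) 3 _ hcne w hw _).1 hn
    have hXred : redMat (X : Matrix (Fin 3) (Fin 3) (w.1.adicCompletion L)) = redMat (((n : ↥(unitaryGroupOfForm (conjLocal L (IsCMField.complexConj L) v) (cmLocalForm L 3 v))) : GL (Fin 3) (LocalRing L v)).val.map (Pi.evalRingHom (fun w' : PlacesOver L v => w'.1.adicCompletion L) w)) := by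
      rw [hXmat]; exact redMat_mul_of_redMat_eq_one htvb (hvb hnint) htred
    refine ⟨hkK, ?_, ?_⟩
    · rw [hkmat, redMat_conj_sub_one_pow_eq_zero_iff hT hXint 3, hXred]; exact hn3 n
    · rw [hkmat, rank_redMat_conj_sub_one_eq hT hXint, hXred]; exact hr
  -- INTERIOR strata: the level-two matrix transported
  have int : ∀ n : ↥(unipotentU (conjLocal L (IsCMField.complexConj L) v) (cmLocalForm L 3 v)), (n : ↥(unitaryGroupOfForm (conjLocal L (IsCMField.complexConj L) v) (cmLocalForm L 3 v))) ∈ cmLocalIntegralLevel L 3 (Matrix.of fun i j : Fin 3 => if i.val + j.val + 1 = 3 then (1 : L) else 0) v → (redMat (((n : ↥(unitaryGroupOfForm (conjLocal L (IsCMField.complexConj L) v) (cmLocalForm L 3 v))) : GL (Fin 3) (LocalRing L v)).val.map (Pi.evalRingHom (fun w' : PlacesOver L v => w'.1.adicCompletion L) w)) - 1).rank = 0 → ∀ s : ℕ,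
      (redMat (ϖ⁻¹ • ((((n : ↥(unitaryGroupOfForm (conjLocal L (IsCMField.complexConj L) v) (cmLocalForm L 3 v))) : GL (Fin 3) (LocalRing L v)).val.map (Pi.evalRingHom (fun w' : PlacesOver L v => w'.1.adicCompletion L) w)) - 1))).rank = s →
      ψ.symm ((t : ↥(unitaryGroupOfForm (conjLocal L (IsCMField.complexConj L) v) (cmLocalForm L 3 v))) * (n : ↥(unitaryGroupOfForm (conjLocal L (IsCMField.complexConj L) v) (cmLocalForm L 3 v)))) ∈ cmLocalIntegralLevel L 3 H' v ∧
      (∀ a b, Valued.v (ϖ⁻¹ * ((((ψ.symm ((t : ↥(unitaryGroupOfForm (conjLocal L (IsCMField.complexConj L) v) (cmLocalForm L 3 v))) * (n : ↥(unitaryGroupOfForm (conjLocal L (IsCMField.complexConj L) v) (cmLocalForm L 3 v))))).val : GL (Fin 3) (UnitaryGroup.LocalRing L v)).val.map (Pi.evalRingHom (fun w' : PlacesOver L v => w'.1.adicCompletion L) w)) a b - (1 : Matrix (Fin 3) (Fin 3) (w.1.adicCompletion L)) a b)) ≤ 1) ∧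
      (redMat (ϖ⁻¹ • ((((ψ.symm ((t : ↥(unitaryGroupOfForm (conjLocal L (IsCMField.complexConj L) v) (cmLocalForm L 3 v))) * (n : ↥(unitaryGroupOfForm (conjLocal L (IsCMField.complexConj L) v) (cmLocalForm L 3 v))))).val : GL (Fin 3) (UnitaryGroup.LocalRing L v)).val.map (Pi.evalRingHom (fun w' : PlacesOver L v => w'.1.adicCompletion L) w)) - 1))) ^ 3 = 0 ∧ (redMat (ϖ⁻¹ • ((((ψ.symm ((t : ↥(unitaryGroupOfForm (conjLocal L (IsCMField.complexConj L) v) (cmLocalForm L 3 v))) * (n : ↥(unitaryGroupOfForm (conjLocal L (IsCMField.complexConj L) v) (cmLocalForm L 3 v))))).val : GL (Fin 3) (UnitaryGroup.LocalRing L v)).val.map (Pi.evalRingHom (fun w' : PlacesOver L v => w'.1.adicCompletion L) w)) - 1))).rank = s := by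
    intro n hn h0 s hs
    obtain ⟨hkK, X, hXint, hkmat, hXmat⟩ := key n hn
    obtain ⟨hnvb, hn1vb, hn3'⟩ := valBound_smul_map_sub_one_of_rank_eq_zero_of_valued_eq L w hw hϖ h2w n hn h0
    obtain ⟨hM1, hMred⟩ := redMat_inv_smul_mul_sub_one_of_two_deep L w hP0 hP1 ht2vb hnvb hn1vb
    have hMc : ValBound 1 (((T⁻¹ : GL (Fin 3) (w.1.adicCompletion L)) : Matrix (Fin 3) (Fin 3) (w.1.adicCompletion L)) * (ϖ⁻¹ • ((((t : ↥(unitaryGroupOfForm (conjLocal L (IsCMField.complexConj L) v) (cmLocalForm L 3 v))) : GL (Fin 3) (LocalRing L v)).val.map (Pi.evalRingHom (fun w' : PlacesOver L v => w'.1.adicCompletion L) w)) * (((n : ↥(unitaryGroupOfForm (conjLocal L (IsCMField.complexConj L) v) (cmLocalForm L 3 v))) : GL (Fin 3) (LocalRing L v)).val.map (Pi.evalRingHom (fun w' : PlacesOver L v => w'.1.adicCompletion L) w)) - 1)) * (T : Matrix (Fin 3) (Fin 3) (w.1.adicCompletion L))) := by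
      have h1 := hvbT.2.mul hM1; rw [one_mul] at h1
      have h2 := h1.mul hvbT.1; rw [one_mul] at h2
      exact h2
    have hk2 : ϖ⁻¹ • ((((ψ.symm ((t : ↥(unitaryGroupOfForm (conjLocal L (IsCMField.complexConj L) v) (cmLocalForm L 3 v))) * (n : ↥(unitaryGroupOfForm (conjLocal L (IsCMField.complexConj L) v) (cmLocalForm L 3 v))))).val : GL (Fin 3) (UnitaryGroup.LocalRing L v)).val.map (Pi.evalRingHom (fun w' : PlacesOver L v => w'.1.adicCompletion L) w)) - 1) =
        ((T⁻¹ : GL (Fin 3) (w.1.adicCompletion L)) : Matrix (Fin 3) (Fin 3) (w.1.adicCompletion L)) * (ϖ⁻¹ • ((((t : ↥(unitaryGroupOfForm (conjLocal L (IsCMField.complexConj L) v) (cmLocalForm L 3 v))) : GL (Fin 3) (LocalRing L v)).val.map (Pi.evalRingHom (fun w' : PlacesOver L v => w'.1.adicCompletion L) w)) * (((n : ↥(unitaryGroupOfForm (conjLocal L (IsCMField.complexConj L) v) (cmLocalForm L 3 v))) : GL (Fin 3) (LocalRing L v)).val.map (Pi.evalRingHom (fun w' : PlacesOver L v => w'.1.adicCompletion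 L) w)) - 1)) * (T : Matrix (Fin 3) (Fin 3) (w.1.adicCompletion L)) := by
      rw [hkmat, Units.val_mul, Units.val_mul, inv_smul_coe_inv_mul_mul_coe_sub_one, hXmat]
    obtain ⟨hrank, hnil⟩ := rank_redMat_coe_inv_mul_mul_coe L w hT hM1
    refine ⟨hkK, fun a b => ?_, ?_, ?_⟩
    · have e := congrFun (congrFun hk2 a) b
      rw [Matrix.smul_apply, Matrix.sub_apply, smul_eq_mul] at e
      rw [e]
      exact (v_le_one_iff_valuation_le_one _).2 (hMc a b)
    · rw [hk2, hnil, hMred]; exact hn3'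
    · rw [hk2, hrank, hMred]; exact hs
  refine ⟨fun n hn hr => ?_, fun n hn h0 hs => ?_, fun n hn h0 hs => ?_, fun n hn h0 hs => ?_, fun n hn => ?_⟩
  · obtain ⟨hkK, hk3, hkr⟩ := bd n hn 2 hr
    obtain ⟨y, hy⟩ := wit n
    exact hc _ ⟨hkK, hk3, hkr, y, hy⟩
  · obtain ⟨hkK, hl1, hk3, hkr⟩ := int n hn h0 2 hs
    exact hc'.2.2 _ ⟨hkK, hl1, hk3, hkr⟩
  · obtain ⟨hkK, hl1, hk3, hkr⟩ := int n hn h0 1 hs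
    exact hc'.2.1 _ ⟨hkK, hl1, hk3, hkr⟩
  · obtain ⟨hkK, hl1, hk3, hkr⟩ := int n hn h0 0 hs
    exact hc'.1 _ ⟨hkK, hl1, hk3, hkr⟩
  · have hψk : ψ (ψ.symm ((t : ↥(unitaryGroupOfForm (conjLocal L (IsCMField.complexConj L) v) (cmLocalForm L 3 v))) * (n : ↥(unitaryGroupOfForm (conjLocal L (IsCMField.complexConj L) v) (cmLocalForm L 3 v))))) = ((t : ↥(unitaryGroupOfForm (conjLocal L (IsCMField.complexConj L) v) (cmLocalForm L 3 v))) * (n : ↥(unitaryGroupOfForm (conjLocal L (IsCMField.complexConj L) v) (cmLocalForm L 3 v)))) := ψ.apply_symm_apply _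
    have hkK : ψ.symm ((t : ↥(unitaryGroupOfForm (conjLocal L (IsCMField.complexConj L) v) (cmLocalForm L 3 v))) * (n : ↥(unitaryGroupOfForm (conjLocal L (IsCMField.complexConj L) v) (cmLocalForm L 3 v)))) ∉ cmLocalIntegralLevel L 3 H' v := fun h => hn (by
      have h' := (hψK _).2 h
      rw [hψk] at h'
      exact (Subgroup.mul_mem_cancel_left _ htK).1 h')
    exact image_eq_zero_of_notMem_tsupport fun h => hkK (hgK h)

/-! ## §5 The canonical orbital integral of a level-two piece at a 2-deep regular split-torus class -/

set_option maxHeartbeats 1600000 in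
-- instance-term unification on the CM local carriers (as in ★ FILE D ∕ ★ p846544)
include hw in
/-- **THE `G`-SIDE OF THE RAMIFIED LEVI CLAUSE.**  Setting of ★ `classOrbitalIntegral_eq_mul_of_level_frame_of_integral_eq` (frame `ψ` with `hψK`, `hψc` and its
matrix reading `hψT`, `T ∈ GL₃(𝒪_w)`; `m_G` canonical; `μ_N` any Haar measure of `N`; `t = diag(d)` REGULAR with `ψ γ₀ = t`), `v` TAMELY RAMIFIED in `L` (`e(w|v) ≠ 1`,
`|2|_w = 1`), `ϖ ∈ L_w` with `|ϖ| = exp(−1)`, `t` 2-DEEP in `w`, and `g` Borel, `Ad K′`-invariant, supported in `K′`, with the value pins `hc` (boundary-regular, `c₂`) and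
`hc′` (the `𝔭`-layer, `c′ 0, c′ 1, c′ 2`).  Then
**`classOrbitalIntegral m_G g ⟦γ₀⟧ = ν_G(K′) · J₃(t) · (c₂·(1 − q⁻¹) + q⁻¹·(c′ 2·(1 − q⁻¹) + c′ 1·q⁻¹(1 − q⁻¹) + c′ 0·q⁻²))`**, `q = N𝔭_v`
(§4 ∘ ★ `integral_eq_of_levelTwo_strata_of_ramified` ∘ the socket) — the binder shape of the CORE-ram socket `hX` of ★ p846879 with `deep d := ∀ i, |d_{i,w} − 1| ≤ exp(−2)`.
Ramified twin of ★ `classOrbitalIntegral_eq_mul_levelTwoStrata_of_torus_twoDeep`.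
[cite: Rogawski1990, §4.9 Prop. 4.9.1 pp. 54–56; §4.3 (4.3.1) p. 43; §12.2 p. 173] [cite: Kottwitz1986, §3] [cite: Jacobowitz1962, §5] -/
theorem classOrbitalIntegral_eq_mul_levelTwoStrata_of_torus_twoDeep_of_ramified
    (H' : Matrix (Fin 3) (Fin 3) L)
    (hH : (H'.map (IsCMField.complexConj L))ᵀ = H') (hHd : IsUnit H'.det)
    [MeasurableSpace ((cmDatum L 3 H').Local v)] [BorelSpace ((cmDatum L 3 H').Local v)]
    [∀ γ : (cmDatum L 3 H').Local v, MeasurableSpace (((cmDatum L 3 H').Local v) ⧸ Subgroup.centralizer ({γ} : Set ((cmDatum L 3 H').Local v)))]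
    [∀ γ : (cmDatum L 3 H').Local v, BorelSpace (((cmDatum L 3 H').Local v) ⧸ Subgroup.centralizer ({γ} : Set ((cmDatum L 3 H').Local v)))]
    (νG : Measure ((cmDatum L 3 H').Local v)) [νG.IsHaarMeasure] [νG.IsMulRightInvariant]
    {mG : OrbitalMeasureFamily ((cmDatum L 3 H').Local v)}
    (hmG : mG.IsCanonical (fun γ => IsRegularElt (γ.val : GL (Fin 3) (LocalRing L v))) νG)
    [MeasurableSpace ↥(unitaryGroupOfForm (conjLocal L (IsCMField.complexConj L) v) (cmLocalForm L 3 v))]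
    [BorelSpace ↥(unitaryGroupOfForm (conjLocal L (IsCMField.complexConj L) v) (cmLocalForm L 3 v))]
    (ψ : (cmDatum L 3 H').Local v ≃ₜ* ↥(unitaryGroupOfForm (conjLocal L (IsCMField.complexConj L) v) (cmLocalForm L 3 v)))
    (hψK : ∀ g : (cmDatum L 3 H').Local v, ψ g ∈ cmLocalIntegralLevel L 3 (Matrix.of fun i j : Fin 3 => if i.val + j.val + 1 = 3 then (1 : L) else 0) v ↔
      g ∈ cmLocalIntegralLevel L 3 H' v)
    (hψc : ∀ g : (cmDatum L 3 H').Local v, IsConj (g.val : GL (Fin 3) (LocalRing L v))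
      ((ψ g : ↥(unitaryGroupOfForm (conjLocal L (IsCMField.complexConj L) v) (cmLocalForm L 3 v))) : GL (Fin 3) (LocalRing L v)))
    (μN : Measure ↥(unipotentU (conjLocal L (IsCMField.complexConj L) v) (cmLocalForm L 3 v))) [μN.IsHaarMeasure]
    (t : ↥(torusU (conjLocal L (IsCMField.complexConj L) v) (cmLocalForm L 3 v))) {d : Fin 3 → (LocalRing L v)ˣ}
    (hd : glDiagonal 3 (LocalRing L v) d =
      ((t : ↥(unitaryGroupOfForm (conjLocal L (IsCMField.complexConj L) v) (cmLocalForm L 3 v))) : GL (Fin 3) (LocalRing L v)))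
    (hreg : ∀ i j, i ≠ j → IsUnit ((d i : LocalRing L v) - d j))
    (ha' : IsUnit ((((d 0)⁻¹ * d 1 : (LocalRing L v)ˣ) : LocalRing L v) - 1))
    (hb' : IsUnit ((((d 0)⁻¹ * d 2 : (LocalRing L v)ˣ) : LocalRing L v) - 1))
    {γ₀ : (cmDatum L 3 H').Local v} (hγ₀ : ψ γ₀ = (t : ↥(unitaryGroupOfForm (conjLocal L (IsCMField.complexConj L) v) (cmLocalForm L 3 v))))
    (g : (cmDatum L 3 H').Local v → ℂ) (hgm : Measurable g)
    (hginv : ∀ u ∈ cmLocalIntegralLevel L 3 H' v, ∀ x, g (u * x * u⁻¹) = g x)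
    (T : GL (Fin 3) (w.1.adicCompletion L)) (hT : T ∈ glInt 3 (w.1.adicCompletion L))
    (hψT : ∀ g : (cmDatum L 3 H').Local v, localGLPiEquiv L 3 v
        (((ψ g : ↥(unitaryGroupOfForm (conjLocal L (IsCMField.complexConj L) v) (cmLocalForm L 3 v)))) : GL (Fin 3) (LocalRing L v)) w =
      T * localGLPiEquiv L 3 v (g.val : GL (Fin 3) (LocalRing L v)) w * T⁻¹)
    (he : v.asIdeal.ramificationIdx' w.1.asIdeal ≠ 1) {ϖ : w.1.adicCompletion L} (hϖ : Valued.v ϖ = WithZero.exp (-1 : ℤ)) (h2w : Valued.v (2 : w.1.adicCompletion L) = 1)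
    (ht2 : ∀ i : Fin 3, Valued.v ((((d i : (LocalRing L v)ˣ) : LocalRing L v) w) - 1) ≤ WithZero.exp (-2 : ℤ))
    (hgK : tsupport g ⊆ (cmLocalIntegralLevel L 3 H' v : Set ((cmDatum L 3 H').Local v)))
    (c₂ : ℂ) (c' : ℕ → ℂ) (hc : ∀ x : ((cmDatum L 3 H').Local v), (x ∈ cmLocalIntegralLevel L 3 H' v ∧ (redMat (((x).val : GL (Fin 3) (UnitaryGroup.LocalRing L v)).val.map (Pi.evalRingHom (fun w' : PlacesOver L v => w'.1.adicCompletion L) w)) - 1) ^ 3 = 0 ∧ (redMat (((x).val : GL (Fin 3) (UnitaryGroup.LocalRing L v)).val.map (Pi.evalRingHom (fun w' : PlacesOver L v => w'.1.adicCompletion L) w)) - 1).rank = 2 ∧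
        ∃ y : ((cmDatum L 3 H').Local v), (∀ a b, Valued.v (((toPlace v w (HeckeCharacter.uniformizer ↥(maximalRealSubfield L) v : v.adicCompletion ↥(maximalRealSubfield L))) ^ 1)⁻¹ *
        ((((localNonsplitEquiv (IsCMField.complexConj L) H' (IsCMField.complexConj_ne_one L) w hw (y * x * y⁻¹) :
            ↥(unitaryGroupOfForm (galAdicCompletionMap (L := L) (IsCMField.complexConj L) hw) (placeForm H' w.1))) : GL (Fin 3) (w.1.adicCompletion L)) :
              Matrix (Fin 3) (Fin 3) (w.1.adicCompletion L)) a b - (1 : Matrix (Fin 3) (Fin 3) (w.1.adicCompletion L)) a b)) ≤ 1)) → g x = c₂)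
    (hc' : ((∀ x : ((cmDatum L 3 H').Local v), (x ∈ cmLocalIntegralLevel L 3 H' v ∧ (∀ a b, Valued.v (ϖ⁻¹ * ((((x).val : GL (Fin 3) (UnitaryGroup.LocalRing L v)).val.map (Pi.evalRingHom (fun w' : PlacesOver L v => w'.1.adicCompletion L) w)) a b - (1 : Matrix (Fin 3) (Fin 3) (w.1.adicCompletion L)) a b)) ≤ 1) ∧
        (redMat (ϖ⁻¹ • ((((x).val : GL (Fin 3) (UnitaryGroup.LocalRing L v)).val.map (Pi.evalRingHom (fun w' : PlacesOver L v => w'.1.adicCompletion L) w)) - 1))) ^ 3 = 0 ∧ (redMat (ϖ⁻¹ • ((((x).val : GL (Fin 3) (UnitaryGroup.LocalRing L v)).val.map (Pi.evalRingHom (fun w' : PlacesOver L v => w'.1.adicCompletion L) w)) - 1))).rank = 0) → g x = c' 0) ∧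
      (∀ x : ((cmDatum L 3 H').Local v), (x ∈ cmLocalIntegralLevel L 3 H' v ∧ (∀ a b, Valued.v (ϖ⁻¹ * ((((x).val : GL (Fin 3) (UnitaryGroup.LocalRing L v)).val.map (Pi.evalRingHom (fun w' : PlacesOver L v => w'.1.adicCompletion L) w)) a b - (1 : Matrix (Fin 3) (Fin 3) (w.1.adicCompletion L)) a b)) ≤ 1) ∧
        (redMat (ϖ⁻¹ • ((((x).val : GL (Fin 3) (UnitaryGroup.LocalRing L v)).val.map (Pi.evalRingHom (fun w' : PlacesOver L v => w'.1.adicCompletion L) w)) - 1))) ^ 3 = 0 ∧ (redMat (ϖ⁻¹ • ((((x).val : GL (Fin 3) (UnitaryGroup.LocalRing L v)).val.map (Pi.evalRingHom (fun w' : PlacesOver L v => w'.1.adicCompletion L) w)) - 1))).rank = 1) → g x = c' 1) ∧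
      (∀ x : ((cmDatum L 3 H').Local v), (x ∈ cmLocalIntegralLevel L 3 H' v ∧ (∀ a b, Valued.v (ϖ⁻¹ * ((((x).val : GL (Fin 3) (UnitaryGroup.LocalRing L v)).val.map (Pi.evalRingHom (fun w' : PlacesOver L v => w'.1.adicCompletion L) w)) a b - (1 : Matrix (Fin 3) (Fin 3) (w.1.adicCompletion L)) a b)) ≤ 1) ∧
        (redMat (ϖ⁻¹ • ((((x).val : GL (Fin 3) (UnitaryGroup.LocalRing L v)).val.map (Pi.evalRingHom (fun w' : PlacesOver L v => w'.1.adicCompletion L) w)) - 1))) ^ 3 = 0 ∧ (redMat (ϖ⁻¹ • ((((x).val : GL (Fin 3) (UnitaryGroup.LocalRing L v)).val.map (Pi.evalRingHom (fun w' : PlacesOver L v => w'.1.adicCompletion L) w)) - 1))).rank = 2) → g x = c' 2))) :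
    classOrbitalIntegral mG g (ConjClasses.mk γ₀) =
      (νG.real (cmLocalIntegralLevel L 3 H' v : Set ((cmDatum L 3 H').Local v)) : ℂ) *
        (((letI : MeasurableSpace (LocalRing L v) := borel _; haveI : BorelSpace (LocalRing L v) := ⟨rfl⟩
          haveI : SecondCountableTopology (LocalRing L v) := secondCountableTopology_localRing (E := L) v
          ((distribHaarChar (LocalRing L v) ha'.unit)⁻¹ *
            (HeisRing.skewModulus (conjLocal L (IsCMField.complexConj L) v) (continuous_conjLocal L (IsCMField.complexConj L) v) hb'.unit
              (HeisRing.map_unit_torusCentralScalar_sub_one (conjLocal L (IsCMField.complexConj L) v) (cmLocalForm_eq_over L 3 v) t hd hb'))⁻¹ :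
                ℝ≥0)) : ℝ≥0) : ℂ) *
        (c₂ * (1 - (Ideal.absNorm v.asIdeal : ℂ)⁻¹) +
          (Ideal.absNorm v.asIdeal : ℂ)⁻¹ * (c' 2 * (1 - (Ideal.absNorm v.asIdeal : ℂ)⁻¹) + c' 1 * ((Ideal.absNorm v.asIdeal : ℂ)⁻¹ * (1 - (Ideal.absNorm v.asIdeal : ℂ)⁻¹)) +
            c' 0 * ((Ideal.absNorm v.asIdeal : ℂ) ^ 2)⁻¹)) := by
  obtain ⟨hF₅, hF₃, hF₂, hF₁, hF₀⟩ := apply_symm_torus_mul_levelTwo_values_of_ramified L w hw H' ψ hψK T hT hψT he hϖ h2w t hd ha' hb' ht2 g hgK c₂ c' hc hc'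
  exact classOrbitalIntegral_eq_mul_of_level_frame_of_integral_eq L H' hH hHd w hw νG hmG ψ hψK hψc μN t hd hreg ha' hb' hγ₀ g hgm hginv _
    (fun _ => rfl) _ (integral_eq_of_levelTwo_strata_of_ramified L v w hw μN hϖ he h2w (c' 0) (c' 1) (c' 2) c₂ _ hF₅ hF₃ hF₂ hF₁ hF₀)


end Literature.NumberTheory.Automorphic.UnitaryGroup

end
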